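import Mathlib
import Summits.Ventures.PercRepro2.Defs
import Summits.Ventures.PercRepro2.Independence
import Summits.Ventures.PercRepro2.Graph
import Summits.Ventures.PercRepro2.Induced
import Summits.Ventures.PercRepro2.DisagreementSum
import Summits.Ventures.PercRepro2.DisagreementPinned
import Summits.Ventures.PercRepro2.TwoCopyBHK
import Summits.Ventures.PercRepro2.HullDefs
import Summits.Ventures.PercRepro2.HullFlip
import Summits.Ventures.PercRepro2.HullTheoremA

/-!
# The free-count identity: (BASE) as a hull sum (blind cell PercRepro2, typer-1; lead g10
`LEAD-PROOFSHAPES.md` ADDENDUM 24 (2), ASSIGNMENTS v10/v11, asks 2026-08-23T06:43:42Z and 06:56:10Z)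

The weight-free two-colouring count of the cross-cluster BHK kernel (p1's `pinnedCount G z
(crossKernel ends l h o b)`, whose nonnegativity on every minor is `CrossCount` = (BASE)) is twice the
HULL SUM `Σ_{ζ = z off G} 1[h ∉ H_l] · s_{o,l} · 1[h ↔_B b]` where the second colouring is
`flipOn G ζ` (the minor `(G, z)`: `G` = the free edges, the rest pinned to `z`):

* `crossKernel_flipOn`: the kernel at a complementary pair in hull vocabulary;
* `hullSumG`, **`pinnedCount_crossKernel_eq`**: `pinnedCount G z K = 2 · hullSumG G z` — the colour
  swap `flipOn G` on the fibre kills the `b ↔_R h` term into a second copy of the `b ↔_B h` term;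
* `HullRow` (row 2′HULL (i)): every hull sum is nonnegative; **`hullRow_iff_crossCount`**: it is
  literally equivalent to p1's `CrossCount`;
* the free fibre (`G = univ`) in the vocabulary of `HullDefs`/`HullTheoremA`:
  `pinnedCount_univ_crossKernel_eq : pinnedCount univ z K = 2 · Σ_ζ sideSign · outConn`.
-/

namespace Summit.Ventures.PercRepro2

namespace Hull

open scoped Classical

section Pinned

variable {V : Type*} {E : Type*} [Fintype E] [DecidableEq E]
  {R : Type*} [Field R] [LinearOrder R] [IsStrictOrderedRing R]

omit [Fintype E] in
/-- `flipOn` is an involution. -/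
lemma flipOn_flipOn (G : Finset E) (x : Config E) : flipOn G (flipOn G x) = x := by
  funext e
  by_cases he : e ∈ G
  · simp [flipOn, he]
  · simp [flipOn, he]

/-- `flipOn univ` is the colour swap. -/
lemma flipOn_univ (x : Config E) : flipOn Finset.univ x = blue x := by
  funext e
  simp [flipOn, blue]

/-- The hull of `l` for the complementary pair `(ζ, flipOn G ζ)`. -/
def hullG (ends : E → Sym2 V) (G : Finset E) (ζ : Config E) (l : V) : Set V :=
  cluster ends ζ l ∪ cluster ends (flipOn G ζ) l

/-- The side sign of `o` for the complementary pair `(ζ, flipOn G ζ)`. -/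
noncomputable def sideSignG (R : Type*) [Ring R] (ends : E → Sym2 V) (G : Finset E) (ζ : Config E)
    (l o : V) : R :=
  (if o ∈ cluster ends ζ l \ cluster ends (flipOn G ζ) l then 1 else 0) -
    (if o ∈ cluster ends (flipOn G ζ) l \ cluster ends ζ l then 1 else 0)

/-- The hull sum on the minor `(G, z)`:
`Σ_{ζ = z off G} 1[h ∉ H_l] · s_{o,l}(ζ) · 1[h ↔ b in flipOn G ζ]`. -/
noncomputable def hullSumG (R : Type*) [Ring R] (ends : E → Sym2 V) (G : Finset E) (z : Config E)
    (l o h b : V) : R :=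
  ∑ ζ : Config E, if (∀ e, e ∉ G → ζ e = z e) then
    (if h ∉ hullG ends G ζ l then 1 else 0) * sideSignG R ends G ζ l o *
      (if Conn ends (flipOn G ζ) h b then 1 else 0) else 0

omit [Fintype E] in
/-- The hull is symmetric under the pinned colour swap. -/
lemma hullG_flipOn (ends : E → Sym2 V) (G : Finset E) (ζ : Config E) (l : V) :
    hullG ends G (flipOn G ζ) l = hullG ends G ζ l := by
  unfold hullG
  rw [flipOn_flipOn]
  exact Set.union_comm _ _

omit [Fintype E] [LinearOrder R] [IsStrictOrderedRing R] in
/-- The side sign changes sign under the pinned colour swap. -/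
lemma sideSignG_flipOn (ends : E → Sym2 V) (G : Finset E) (ζ : Config E) (l o : V) :
    sideSignG R ends G (flipOn G ζ) l o = -sideSignG R ends G ζ l o := by
  unfold sideSignG
  rw [flipOn_flipOn, neg_sub]

omit [Fintype E] [LinearOrder R] [IsStrictOrderedRing R] in
/-- The side sign as the difference of the two connection indicators. -/
lemma sideSignG_eq (ends : E → Sym2 V) (G : Finset E) (ζ : Config E) (l o : V) :
    sideSignG R ends G ζ l o =
      (if Conn ends ζ l o then 1 else 0) - (if Conn ends (flipOn G ζ) l o then 1 else 0) := by
  unfold sideSignG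
  by_cases h₁ : Conn ends ζ l o <;> by_cases h₂ : Conn ends (flipOn G ζ) l o <;>
    simp [mem_cluster, h₁, h₂]

omit [Fintype E] [LinearOrder R] [IsStrictOrderedRing R] in
/-- **The cross kernel at a complementary pair** in hull vocabulary. -/
lemma crossKernel_flipOn (ends : E → Sym2 V) (G : Finset E) (ζ : Config E) (l h o b : V) :
    crossKernel (R := R) ends l h o b ζ (flipOn G ζ) =
      (if h ∉ hullG ends G ζ l then 1 else 0) * sideSignG R ends G ζ l o *
        ((if Conn ends (flipOn G ζ) h b then 1 else 0) - (if Conn ends ζ h b then 1 else 0)) := by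
  unfold crossKernel
  rw [sideSignG_eq]
  have hQ : ((connEvent ends l h)ᶜ.indicator (1 : Config E → R) ζ) *
      ((connEvent ends l h)ᶜ.indicator (1 : Config E → R) (flipOn G ζ)) =
      if h ∉ hullG ends G ζ l then 1 else 0 := by
    by_cases h₁ : Conn ends ζ l h <;> by_cases h₂ : Conn ends (flipOn G ζ) l h <;>
      simp [connEvent, hullG, mem_cluster, h₁, h₂]
  rw [hQ]
  simp only [Set.indicator_apply, connEvent, Set.mem_setOf_eq, Pi.one_apply]

omit [Fintype E] in
/-- The fibre condition is symmetric under the pinned colour swap. -/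
lemma fibre_flipOn (G : Finset E) (z ζ : Config E) :
    (∀ e, e ∉ G → flipOn G ζ e = z e) ↔ (∀ e, e ∉ G → ζ e = z e) := by
  constructor
  · intro h e he
    rw [← h e he, flipOn_of_notMem G ζ he]
  · intro h e he
    rw [flipOn_of_notMem G ζ he]
    exact h e he

omit [LinearOrder R] [IsStrictOrderedRing R] in
/-- **The free-count identity** (ADDENDUM 24 (2)): `pinnedCount G z K = 2 · hullSumG G z`. -/
theorem pinnedCount_crossKernel_eq (ends : E → Sym2 V) (G : Finset E) (z : Config E)
    (l h o b : V) :
    pinnedCount G z (crossKernel (R := R) ends l h o b) = 2 * hullSumG R ends G z l o h b := by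
  unfold pinnedCount hullSumG
  -- the two pieces of the kernel
  have hsplit : ∀ ζ : Config E,
      (if (∀ e, e ∉ G → ζ e = z e) then crossKernel (R := R) ends l h o b ζ (flipOn G ζ) else 0) =
      (if (∀ e, e ∉ G → ζ e = z e) then
        (if h ∉ hullG ends G ζ l then 1 else 0) * sideSignG R ends G ζ l o *
          (if Conn ends (flipOn G ζ) h b then 1 else 0) else 0) -
      (if (∀ e, e ∉ G → ζ e = z e) then
        (if h ∉ hullG ends G ζ l then 1 else 0) * sideSignG R ends G ζ l o *
          (if Conn ends ζ h b then 1 else 0) else 0) := by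
    intro ζ
    rw [crossKernel_flipOn]
    split_ifs <;> ring
  simp_rw [hsplit]
  rw [Finset.sum_sub_distrib]
  -- the second sum is minus the first, by the colour swap on the fibre
  have hswap : (∑ ζ : Config E, if (∀ e, e ∉ G → ζ e = z e) then
        (if h ∉ hullG ends G ζ l then 1 else 0) * sideSignG R ends G ζ l o *
          (if Conn ends ζ h b then 1 else 0) else 0) =
      -(∑ ζ : Config E, if (∀ e, e ∉ G → ζ e = z e) then
        (if h ∉ hullG ends G ζ l then 1 else 0) * sideSignG R ends G ζ l o *
          (if Conn ends (flipOn G ζ) h b then 1 else 0) else 0) := by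
    rw [← Finset.sum_neg_distrib]
    refine Fintype.sum_bijective (flipOn G) (Function.Involutive.bijective (flipOn_flipOn G)) _ _ ?_
    intro ζ
    rw [flipOn_flipOn, hullG_flipOn, sideSignG_flipOn]
    by_cases hf : ∀ e, e ∉ G → ζ e = z e
    · rw [if_pos hf, if_pos ((fibre_flipOn G z ζ).2 hf)]
      ring
    · rw [if_neg hf, if_neg (fun h => hf ((fibre_flipOn G z ζ).1 h)), neg_zero]
  rw [hswap]
  ring

/-- **Row 2′HULL (i)**: every hull sum (every minor) is nonnegative. -/
def HullRow (R : Type*) [Ring R] [LinearOrder R] (ends : E → Sym2 V) (l o h b : V) : Prop :=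
  ∀ (G : Finset E) (z : Config E), 0 ≤ hullSumG R ends G z l o h b

/-- Row 2′HULL is literally p1's `CrossCount` (= (BASE) on every minor). -/
theorem hullRow_iff_crossCount (ends : E → Sym2 V) (l o h b : V) :
    HullRow R ends l o h b ↔ CrossCount R ends l h o b := by
  constructor
  · intro hr G z
    rw [pinnedCount_crossKernel_eq]
    exact mul_nonneg zero_le_two (hr G z)
  · intro hc G z
    have h := hc G z
    rw [pinnedCount_crossKernel_eq] at h
    exact (mul_nonneg_iff_of_pos_left zero_lt_two).1 h

end Pinned

/-! ## The free fibre in the vocabulary of `HullDefs` -/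

section Free

variable {V : Type*} {E : Type*} [Fintype E] [DecidableEq E]
  {R : Type*} [Field R] [LinearOrder R] [IsStrictOrderedRing R]

/-- On the free fibre the pinned hull is the hull. -/
lemma hullG_univ (ends : E → Sym2 V) (ζ : Config E) (l : V) :
    hullG ends Finset.univ ζ l = hull ends ζ l := by
  unfold hullG hull
  rw [flipOn_univ]

omit [LinearOrder R] [IsStrictOrderedRing R] in
/-- On the free fibre the pinned side sign is the side sign. -/
lemma sideSignG_univ (ends : E → Sym2 V) (ζ : Config E) (l o : V) :
    sideSignG R ends Finset.univ ζ l o = sideSign R ends ζ l o := by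
  unfold sideSignG sideSign rside bside
  rw [flipOn_univ]
  by_cases h₁ : o ∈ cluster ends ζ l \ cluster ends (blue ζ) l <;>
    by_cases h₂ : o ∈ cluster ends (blue ζ) l \ cluster ends ζ l <;> simp [h₁, h₂]

omit [LinearOrder R] [IsStrictOrderedRing R] in
/-- The free-fibre hull sum is `Σ_ζ s_{o,l} · outConn`. -/
lemma hullSumG_univ (ends : E → Sym2 V) (z : Config E) (l o h b : V) :
    hullSumG R ends Finset.univ z l o h b =
      ∑ ζ : Config E, sideSign R ends ζ l o * outConn R ends l h b ζ := by
  unfold hullSumG outConn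
  refine Finset.sum_congr rfl fun ζ _ => ?_
  rw [if_pos (fun e he => absurd (Finset.mem_univ e) he), hullG_univ, sideSignG_univ, flipOn_univ]
  ring

omit [LinearOrder R] [IsStrictOrderedRing R] in
/-- **The free-count identity on the free fibre**: `pinnedCount univ z K = 2 · Σ_ζ s_{o,l} · outConn`. -/
theorem pinnedCount_univ_crossKernel_eq (ends : E → Sym2 V) (z : Config E) (l h o b : V) :
    pinnedCount Finset.univ z (crossKernel (R := R) ends l h o b) =
      2 * ∑ ζ : Config E, sideSign R ends ζ l o * outConn R ends l h b ζ := by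
  rw [pinnedCount_crossKernel_eq, hullSumG_univ]

end Free

end Hull

end Summit.Ventures.PercRepro2
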